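import Summits.QuantumFields.YangMills.Theorems.UV3AxialLaunderingFreeSlot
import HarnessLib

/-!
# R3 (cell `ym3-torus`, YM₃ on T³ — a ladder RUNG, NOT d = 4, NOT infinite volume, NOT a mass gap, NOT the Clay problem) —
# **FREE-SLOT LAUNDERING WITH SPECTATORS: if neither the density `f` nor the spectator `φ` reads one chosen bond of every straight segment, the straight
# transporter pushes `f·dU_j`, JOINTLY with `φ`, to `((f·dU_j)∘φ⁻¹) ⊗ dU_{j+1}` — the laundered coarse field is exactly Haar AND independent of the spectator**

Width seat `ym3-torus-px8` g12 on crux `stmt-QuantumFields-19936` `UnitScaleTilt.HistoryTailL` (`--supports`, helper; THEOREMS ONLY, 0 `def`, 0 `sorry`).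
Sequel of ✓`UV3AxialLaunderingFreeSlot` (p755566: the spectator-free free-slot form) and the free-slot twin of the N08 seat's
✓`BalabanUVNodesN08AxialLaunderingSpectator.map_withDensity_prod_axialAvg_eq` (`pub-ymgap-dag-n08-d` g47, p754656: LAST bond free), which the hTop design
(`N08-HJ-LOOPPART-DESIGN-g47.md` §2 (R2), milestone (M4)) uses with «the other clusters» as the spectator.

THE ARGUMENT.  No new Fubini: for a measurable `B ⊆ Y` the density `g := f·(1_B∘φ)` again leaves the slot bonds unread, so the free-slot theorem gives
`((dU_j).withDensity g).map Ū = (∫g)•dU_{j+1}`; evaluated at `A` this is the rectangle identity `LHS(B × A) = ((f·dU_j)∘φ⁻¹)(B)·dU_{j+1}(A)`, and two finite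
measures agreeing on rectangles with a σ-finite product agree (`Measure.prod_eq`).  Finiteness of `∫f` is assumed here (product uniqueness), not in p755566.

CONTENTS. ★★★ `map_withDensity_prod_axialAvg_eq_of_freeSlot`; ★★ `map_withDensity_prod_axialAvg_eq_of_readSet` (read-set form: `f` and `φ` read only `R`, every segment
has its slot outside `R`); ★ `map_restrict_prod_axialAvg_eq_of_freeSlot` (event form); `…_of_lastSlot` (= p754656 §2 by specialisation `t ≡ L − 1`).

HONEST SCOPE.  [folklore] measure theory on lit `AveragingRT` objects; N08-vocabulary-free; nothing of hTop ∕ (M3) ∕ (M4) ∕ hJ ∕ `HistoryTailL` (19936) ∕ the rung ∕ d = 4 ∕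
a mass gap ∕ Clay is proved here.  YM₃ on T³ is rung R3 of the ladder, not the Clay problem.

References: T. Bałaban, Commun. Math. Phys. **109** (1987) 249–301 [Balaban1987RG1] ((0.4) p. 253); T. Bałaban, Commun. Math. Phys. **98** (1985) 17–51
[Balaban1985Averaging] ((10) p. 19).
-/

set_option autoImplicit false

noncomputable section

open MeasureTheory
open scoped ENNReal

namespace Summit.QuantumFields.YangMills.Theorems.UV3AxialLaunderingFreeSlotSpectator

open Literature.MathematicalPhysics.QuantumFieldTheory.Balaban1983to89
open Literature.MathematicalPhysics.QuantumFieldTheory.Balaban1983to89.AveragingRT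
open Summit.QuantumFields.YangMills.Theorems.UV3AxialLaunderingFreeSlot

variable {P : Params} {j : ℕ} {G : Type*} [GaugeGroup G] [MeasurableSpace G] [HaarData G] [MeasurableMul₂ G]
  {Y : Type*} [MeasurableSpace Y]

/-- ★★★ **FREE-SLOT LAUNDERING WITH A SPECTATOR.**  Slots `t(c) < L`, one per straight segment; `f ≥ 0` measurable with finite integral and `φ : fields → Y`
measurable, BOTH invariant under right-multiplication of the slot bond of every segment by an arbitrary coarse field.  Then
`((dU_j).withDensity f).map (U ↦ (φ U, Ū U)) = (((dU_j).withDensity f).map φ) ⊗ dU_{j+1}`: under `f·dU_j` the axially averaged field is exactly Haar and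
independent of `φ` (standing range). [cite: Balaban1987RG1, (0.4) p.253; Balaban1985Averaging, (10) p.19] -/
theorem map_withDensity_prod_axialAvg_eq_of_freeSlot (hj : j + 1 ≤ P.m + P.K) (t : PBond P (j + 1) → ℕ) (ht : ∀ c, t c < P.L)
    {f : GaugeField P j G → ℝ≥0∞} (hf : Measurable f) (hfin : ∫⁻ U, f U ∂(fieldMeasure P j G) ≠ ∞)
    {φ : GaugeField P j G → Y} (hφ : Measurable φ)
    (hfree : ∀ (k : GaugeField P (j + 1) G) (U : GaugeField P j G),
      f (fun b => U b * Function.extend (fun c : PBond P (j + 1) => line c (t c)) k (fun _ => 1) b) = f U)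
    (hφfree : ∀ (k : GaugeField P (j + 1) G) (U : GaugeField P j G),
      φ (fun b => U b * Function.extend (fun c : PBond P (j + 1) => line c (t c)) k (fun _ => 1) b) = φ U) :
    ((fieldMeasure P j G).withDensity f).map (fun U => (φ U, axialAvg U)) =
      (((fieldMeasure P j G).withDensity f).map φ).prod (fieldMeasure P (j + 1) G) := by
  have hmeas : Measurable (axialAvg : GaugeField P j G → GaugeField P (j + 1) G) := measurable_axialAvg
  have hpair : Measurable fun U : GaugeField P j G => (φ U, axialAvg U) := hφ.prodMk hmeas
  haveI : IsFiniteMeasure ((fieldMeasure P j G).withDensity f) := isFiniteMeasure_withDensity hfin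
  haveI : IsFiniteMeasure (((fieldMeasure P j G).withDensity f).map φ) := Measure.isFiniteMeasure_map _ _
  haveI : IsFiniteMeasure (((fieldMeasure P j G).withDensity f).map fun U => (φ U, axialAvg U)) :=
    Measure.isFiniteMeasure_map _ _
  symm
  refine Measure.prod_eq fun B A hB hA => ?_
  -- the density `g := f · 1_B ∘ φ` leaves the slots unread
  set g : GaugeField P j G → ℝ≥0∞ := fun U => f U * B.indicator (fun _ => (1 : ℝ≥0∞)) (φ U) with hg
  have hBi : Measurable fun y : Y => B.indicator (fun _ => (1 : ℝ≥0∞)) y := measurable_const.indicator hB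
  have hgm : Measurable g := hf.mul (hBi.comp hφ)
  have hgfree : ∀ (k : GaugeField P (j + 1) G) (U : GaugeField P j G),
      g (fun b => U b * Function.extend (fun c : PBond P (j + 1) => line c (t c)) k (fun _ => 1) b) = g U := by
    intro k U
    show f _ * B.indicator _ (φ _) = f U * B.indicator _ (φ U)
    rw [hfree k U, hφfree k U]
  have key := map_withDensity_axialAvg_eq_smul_of_freeSlot hj t ht hgm hgfree
  -- evaluate the laundering identity for `g` at `A`
  have hkeyA := congrArg (fun μ : Measure (GaugeField P (j + 1) G) => μ A) key
  simp only [Measure.map_apply hmeas hA, withDensity_apply _ (hmeas hA), Measure.smul_apply, smul_eq_mul] at hkeyA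
  -- left side: the rectangle under the pair map
  rw [Measure.map_apply hpair (hB.prod hA), withDensity_apply _ (hpair (hB.prod hA)),
    Measure.map_apply hφ hB, withDensity_apply _ (hφ hB)]
  -- `∫_{(φ,Ū)⁻¹(B×A)} f = ∫_{Ū⁻¹A} g`
  have h1 : ∫⁻ U in (fun U => (φ U, axialAvg U)) ⁻¹' (B ×ˢ A), f U ∂(fieldMeasure P j G) =
      ∫⁻ U in axialAvg ⁻¹' A, g U ∂(fieldMeasure P j G) := by
    rw [← lintegral_indicator (hpair (hB.prod hA)), ← lintegral_indicator (hmeas hA)]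
    refine lintegral_congr fun U => ?_
    by_cases hUA : axialAvg U ∈ A <;> by_cases hUB : φ U ∈ B
    · rw [Set.indicator_of_mem (show U ∈ (fun U => (φ U, axialAvg U)) ⁻¹' (B ×ˢ A) from ⟨hUB, hUA⟩),
        Set.indicator_of_mem (show U ∈ axialAvg ⁻¹' A from hUA), hg]
      simp only [Set.indicator_of_mem hUB, mul_one]
    · rw [Set.indicator_of_notMem (show U ∉ (fun U => (φ U, axialAvg U)) ⁻¹' (B ×ˢ A) from fun h => hUB h.1),
        Set.indicator_of_mem (show U ∈ axialAvg ⁻¹' A from hUA), hg]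
      simp only [Set.indicator_of_notMem hUB, mul_zero]
    · rw [Set.indicator_of_notMem (show U ∉ (fun U => (φ U, axialAvg U)) ⁻¹' (B ×ˢ A) from fun h => hUA h.2),
        Set.indicator_of_notMem (show U ∉ axialAvg ⁻¹' A from hUA)]
    · rw [Set.indicator_of_notMem (show U ∉ (fun U => (φ U, axialAvg U)) ⁻¹' (B ×ˢ A) from fun h => hUA h.2),
        Set.indicator_of_notMem (show U ∉ axialAvg ⁻¹' A from hUA)]
  -- `∫ g = ∫_{φ⁻¹B} f`
  have h2 : ∫⁻ U, g U ∂(fieldMeasure P j G) = ∫⁻ U in φ ⁻¹' B, f U ∂(fieldMeasure P j G) := by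
    rw [← lintegral_indicator (hφ hB)]
    refine lintegral_congr fun U => ?_
    by_cases hUB : φ U ∈ B
    · rw [hg, Set.indicator_of_mem (show U ∈ φ ⁻¹' B from hUB)]
      simp only [Set.indicator_of_mem hUB, mul_one]
    · rw [hg, Set.indicator_of_notMem (show U ∉ φ ⁻¹' B from hUB)]
      simp only [Set.indicator_of_notMem hUB, mul_zero]
  rw [h1, hkeyA, h2]

/-- ★★ **READ-SET FORM WITH A SPECTATOR**: if `f` and `φ` read only the bonds of `R ⊆ PBond P j` and every straight segment has its slot `line c (t c)` OUTSIDE `R`,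
then `((dU_j).withDensity f).map (U ↦ (φ U, Ū U)) = (((dU_j).withDensity f).map φ) ⊗ dU_{j+1}`. [cite: Balaban1987RG1, (0.4) p.253; Balaban1985Averaging, (10) p.19] -/
theorem map_withDensity_prod_axialAvg_eq_of_readSet (hj : j + 1 ≤ P.m + P.K) (t : PBond P (j + 1) → ℕ) (ht : ∀ c, t c < P.L)
    {f : GaugeField P j G → ℝ≥0∞} (hf : Measurable f) (hfin : ∫⁻ U, f U ∂(fieldMeasure P j G) ≠ ∞)
    {φ : GaugeField P j G → Y} (hφ : Measurable φ) (R : Set (PBond P j))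
    (hRf : ∀ U U' : GaugeField P j G, (∀ b ∈ R, U b = U' b) → f U = f U')
    (hRφ : ∀ U U' : GaugeField P j G, (∀ b ∈ R, U b = U' b) → φ U = φ U')
    (hslot : ∀ c, line c (t c) ∉ R) :
    ((fieldMeasure P j G).withDensity f).map (fun U => (φ U, axialAvg U)) =
      (((fieldMeasure P j G).withDensity f).map φ).prod (fieldMeasure P (j + 1) G) := by
  have hagree : ∀ (k : GaugeField P (j + 1) G) (U : GaugeField P j G), ∀ b ∈ R,
      U b * Function.extend (fun c : PBond P (j + 1) => line c (t c)) k (fun _ => 1) b = U b := by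
    intro k U b hb
    have hb' : ¬ ∃ c, line c (t c) = b := by
      rintro ⟨c, rfl⟩; exact hslot c hb
    rw [Function.extend_apply' _ _ _ hb', mul_one]
  exact map_withDensity_prod_axialAvg_eq_of_freeSlot hj t ht hf hfin hφ (fun k U => hRf _ _ (hagree k U))
    (fun k U => hRφ _ _ (hagree k U))

/-- ★ **EVENT FORM WITH A SPECTATOR**: for a measurable event `E` and a measurable spectator `φ`, both blind to the slot bonds,
`(dU_j↾E).map (U ↦ (φ U, Ū U)) = ((dU_j↾E).map φ) ⊗ dU_{j+1}`. [folklore] -/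
theorem map_restrict_prod_axialAvg_eq_of_freeSlot (hj : j + 1 ≤ P.m + P.K) (t : PBond P (j + 1) → ℕ) (ht : ∀ c, t c < P.L)
    {E : Set (GaugeField P j G)} (hE : MeasurableSet E) {φ : GaugeField P j G → Y} (hφ : Measurable φ)
    (hEfree : ∀ (k : GaugeField P (j + 1) G) (U : GaugeField P j G),
      (fun b => U b * Function.extend (fun c : PBond P (j + 1) => line c (t c)) k (fun _ => 1) b) ∈ E ↔ U ∈ E)
    (hφfree : ∀ (k : GaugeField P (j + 1) G) (U : GaugeField P j G),
      φ (fun b => U b * Function.extend (fun c : PBond P (j + 1) => line c (t c)) k (fun _ => 1) b) = φ U) :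
    ((fieldMeasure P j G).restrict E).map (fun U => (φ U, axialAvg U)) =
      (((fieldMeasure P j G).restrict E).map φ).prod (fieldMeasure P (j + 1) G) := by
  have hinv : ∀ (k : GaugeField P (j + 1) G) (U : GaugeField P j G),
      E.indicator (1 : GaugeField P j G → ℝ≥0∞)
          (fun b => U b * Function.extend (fun c : PBond P (j + 1) => line c (t c)) k (fun _ => 1) b) =
        E.indicator (1 : GaugeField P j G → ℝ≥0∞) U := by
    intro k U
    set R : GaugeField P j G → GaugeField P j G := fun V b =>
      V b * Function.extend (fun c : PBond P (j + 1) => line c (t c)) k (fun _ => 1) b with hR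
    have hpre : R ⁻¹' E = E := Set.ext fun V => hEfree k V
    show E.indicator 1 (R U) = E.indicator 1 U
    rw [← Set.indicator_comp_right, hpre]
    rfl
  have hfin : ∫⁻ U, E.indicator (1 : GaugeField P j G → ℝ≥0∞) U ∂(fieldMeasure P j G) ≠ ∞ := by
    rw [lintegral_indicator_one hE]; exact measure_ne_top _ _
  rw [← withDensity_indicator_one hE]
  exact map_withDensity_prod_axialAvg_eq_of_freeSlot hj t ht (measurable_one.indicator hE) hfin hφ hinv hφfree

/-- **LAST-SLOT COROLLARY** (`t ≡ L − 1`): the N08 seat's ✓`BalabanUVNodesN08AxialLaunderingSpectator.map_withDensity_prod_axialAvg_eq` by specialisation.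
[cite: Balaban1987RG1, (0.4) p.253; Balaban1985Averaging, (10) p.19] -/
theorem map_withDensity_prod_axialAvg_eq_of_lastSlot (hj : j + 1 ≤ P.m + P.K)
    {f : GaugeField P j G → ℝ≥0∞} (hf : Measurable f) (hfin : ∫⁻ U, f U ∂(fieldMeasure P j G) ≠ ∞)
    {φ : GaugeField P j G → Y} (hφ : Measurable φ)
    (hlast : ∀ (k : GaugeField P (j + 1) G) (U : GaugeField P j G),
      f (fun b => U b * Function.extend (fun c : PBond P (j + 1) => line c (P.L - 1)) k (fun _ => 1) b) = f U)
    (hφlast : ∀ (k : GaugeField P (j + 1) G) (U : GaugeField P j G),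
      φ (fun b => U b * Function.extend (fun c : PBond P (j + 1) => line c (P.L - 1)) k (fun _ => 1) b) = φ U) :
    ((fieldMeasure P j G).withDensity f).map (fun U => (φ U, axialAvg U)) =
      (((fieldMeasure P j G).withDensity f).map φ).prod (fieldMeasure P (j + 1) G) :=
  map_withDensity_prod_axialAvg_eq_of_freeSlot hj (fun _ => P.L - 1) (fun _ => by have := P.hL.2; omega) hf hfin hφ hlast hφlast

end Summit.QuantumFields.YangMills.Theorems.UV3AxialLaunderingFreeSlotSpectator

end
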